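import Summits.HubbardSuperconductivity.HubbardSuperconductivity.Theorems.CooperPairDMottWalkBindingWalkShibaTorus
import HarnessLib

/-!
# Route `JosephsonMirror` — crux `JmCusp` (stmt-HubbardSuperconductivity-2228):
# the Shiba dictionary for the (i)-side — zero-excess `d`-wave pair order in attractive language

Helper file (`--supports stmt-HubbardSuperconductivity-2228`) for the registered line
`Cruxes/JmCusp/Lines/cocountable_coupling_selection.lean`, companion of
`JosephsonMirrorJmCuspShibaDictionary.lean` (clause (ii) ⇔ simplicity of the half-filled attractive
floor in `S^z = N_L/2 - L²/2`).  The line's open (i)-side input `stub_orderedWindow` asks for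
ZERO-EXCESS `d`-WAVE PAIR ORDER (ZEPO, right-hand side of `josephsonGain_iff_zeroExcessPairOrder`,
p134917) of the repulsive torus on a coupling window: low-energy unit vectors `v` of the doped
sectors `(n, S^z = 0)`, `n ∈ {N_L, N_L - 2}`, with `‖Δ_d v‖² ≥ cL⁴`.  Under the Shiba unitary
`S = orbitalPhase g · partialParticleHole D↓` (tree `shiba_conj_hamiltonian`:
`S H(t,U) Sᴴ = H(t,-U) + U N↑`, sector `(a,b) ↦ (a, L²-b)`):

* `shiba_conj_upDownPair` / `shiba_conj_downUpPair` / `shiba_conj_localPair` / `shiba_conj_pairField`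
  — a singlet pair annihilator becomes a gauged transverse SPIN-FLIP bond operator,
  `S (c_{x↑}c_{y↓}) Sᴴ = -g(y↓) c†_{y↓}c_{x↑}`, `S (c_{x↓}c_{y↑}) Sᴴ = g(x↓) c†_{x↓}c_{y↑}`, hence
  `S Δ_{g'} Sᴴ = Σ_x Σ_e (g'(e)/√2) (-g((x+e)↓) c†_{(x+e)↓}c_{x↑} - g(x↓) c†_{x↓}c_{(x+e)↑})` for ANY
  form factor `g'`; with the torus stagger (`shiba_conj_pairField_dWave_torus`, registered form
  `jmCusp_shiba_pairField_dWave`) this is the `Q = (π,π)` transverse bond spin-density wave with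
  `d_{x²-y²}` form factor — the Shiba image of `d`-wave pairing (Micnas–Ranninger–Robaszkiewicz
  1990 §II.B: pairing ↔ transverse magnetism, doping ↔ magnetisation);
* `zepoWitness_shiba` / `zepoWitness_shiba_conjTranspose` — a ZEPO witness of `H(1,U)` in `(2k,0)`
  goes to a witness of `H(1,-U)` at HALF FILLING in the magnetised sector `(L², k - L²/2)` with the
  same excess energy and the same order `‖(SΔ_dSᴴ)(Sv)‖² = ‖Δ_d v‖²`, and back;
* `zeroExcessPairOrder_iff_attractive` — ZEPO at `(U, δ)` (verbatim the window predicate of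
  `stub_orderedWindow` at one coupling) ⇔ zero-excess staggered transverse `d`-wave bond-spin order of
  the ATTRACTIVE half-filled torus in the sectors `S^z = (n - L²)/2`; `orderedWindow_iff_attractive`:
  the same for the whole registered stub (window form).

So BOTH open stubs of the line (hence the crux, p134917/p156144) are stated verbatim in the language
of the half-filled attractive Hubbard model at fixed magnetisation `≈ -δL²/2` — the setting of
spin-reflection positivity (Lieb 1989), with the doping turned into the constraint `N↑ ≠ N↓` those
methods do not cover.  This reformulates the stub; it proves neither the stub nor the crux.  Refs:
Lieb, PRL 62 (1989) 1201, proof of Thm 2; Shiba, Prog. Theor. Phys. 48 (1972) 2171, §2; Micnas–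
Ranninger–Robaszkiewicz, Rev. Mod. Phys. 62 (1990) 113, §II.B.  No definition, no named fact.
-/

set_option linter.dupNamespace false

noncomputable section

namespace Summit.HubbardSuperconductivity.HubbardSuperconductivity.Theorems.JosephsonMirror

open Matrix Finset Literature.MathematicalPhysics.QuantumLattice Literature.Probability.LatticeModels
open Summit.HubbardSuperconductivity.HubbardSuperconductivity.Theorems.CooperPairDMottWalk
open scoped ComplexOrder

section General

variable {Λ : Type*} [LinearOrder Λ] [Fintype Λ]

/-- **`S (c_{x↑} c_{y↓}) Sᴴ = -g(y↓) · c†_{y↓} c_{x↑}`**: under the Shiba unitary a singlet-pair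
annihilator on the bond `(x↑, y↓)` becomes a (gauged) spin-flip hopping `c†_{y↓} c_{x↑}`.
[cite: Lieb1989, proof of Theorem 2] -/
theorem shiba_conj_upDownPair {g : Orb Λ → ℂ} (hg : ∀ i, ‖g i‖ = 1) (hg0 : ∀ x, g (orb x 0) = 1)
    (x y : Λ) :
    orbitalPhase g * partialParticleHole (spinDownOrbitals : Finset (Orb Λ)) *
        (annihilation (orb x 0) * annihilation (orb y 1)) *
        (orbitalPhase g * partialParticleHole (spinDownOrbitals : Finset (Orb Λ)))ᴴ =
      -(g (orb y 1)) • (creation (orb y 1) * annihilation (orb x 0)) := by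
  have hx0 : orb x 0 ∉ (spinDownOrbitals : Finset (Orb Λ)) := by
    rw [orb_mem_spinDownOrbitals_iff]; exact Fin.zero_ne_one
  have hy1 : orb y 1 ∈ (spinDownOrbitals : Finset (Orb Λ)) := by rw [orb_mem_spinDownOrbitals_iff]
  rw [conjTranspose_mul, show orbitalPhase g * partialParticleHole (spinDownOrbitals : Finset (Orb Λ)) *
      (annihilation (orb x 0) * annihilation (orb y 1)) *
      ((partialParticleHole (spinDownOrbitals : Finset (Orb Λ)))ᴴ * (orbitalPhase g)ᴴ) =
      orbitalPhase g * (partialParticleHole (spinDownOrbitals : Finset (Orb Λ)) *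
        (annihilation (orb x 0) * annihilation (orb y 1)) *
        (partialParticleHole (spinDownOrbitals : Finset (Orb Λ)))ᴴ) * (orbitalPhase g)ᴴ by
      simp only [Matrix.mul_assoc], partialParticleHole_conj_pair hx0 hy1, Matrix.mul_neg, Matrix.neg_mul,
    ← orbitalPhaseAut_apply hg, orbitalPhaseAut_creation_mul_annihilation hg, hg0, star_one, mul_one,
    neg_smul]

/-- **`S (c_{x↓} c_{y↑}) Sᴴ = g(x↓) · c†_{x↓} c_{y↑}`** (the other spin order of the singlet pair;
one anticommutation). [cite: Lieb1989, proof of Theorem 2] -/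
theorem shiba_conj_downUpPair {g : Orb Λ → ℂ} (hg : ∀ i, ‖g i‖ = 1) (hg0 : ∀ x, g (orb x 0) = 1)
    (x y : Λ) :
    orbitalPhase g * partialParticleHole (spinDownOrbitals : Finset (Orb Λ)) *
        (annihilation (orb x 1) * annihilation (orb y 0)) *
        (orbitalPhase g * partialParticleHole (spinDownOrbitals : Finset (Orb Λ)))ᴴ =
      (g (orb x 1)) • (creation (orb x 1) * annihilation (orb y 0)) := by
  have hanti : annihilation (orb x 1) * annihilation (orb y 0) =
      -(annihilation (orb y 0) * annihilation (orb x 1)) :=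
    eq_neg_of_add_eq_zero_left (annihilation_anticommute_holds (orb x 1) (orb y 0))
  rw [hanti, Matrix.mul_neg, Matrix.neg_mul, shiba_conj_upDownPair hg hg0 y x, neg_smul, neg_neg]

end General

section PairField

variable (g' : Site 2 → ℝ) (L : ℕ) [NeZero L]

/-- **The local pair operator under `S`**: for any form factor `g'` and any gauge `g` (`g = 1` on
`↑`), `S P_x Sᴴ = Σ_e (g'(e)/√2) (-g((x+e)↓) c†_{(x+e)↓} c_{x↑} - g(x↓) c†_{x↓} c_{(x+e)↑})` — a
transverse spin-flip (`S⁻`-type) bond operator. [cite: MicnasRanningerRobaszkiewicz1990, §II.B] -/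
theorem shiba_conj_localPair {g : Orb (FermionTorus 2 L) → ℂ} (hg : ∀ i, ‖g i‖ = 1)
    (hg0 : ∀ x, g (orb x 0) = 1) (x : TorusSite 2 L) :
    orbitalPhase g * partialParticleHole (spinDownOrbitals : Finset (Orb (FermionTorus 2 L))) *
        localPair g' L x *
        (orbitalPhase g * partialParticleHole (spinDownOrbitals : Finset (Orb (FermionTorus 2 L))))ᴴ =
      ∑ e ∈ insert 0 unitSteps, ((g' e / Real.sqrt 2 : ℝ) : ℂ) •
        (-(g (orb (FermionTorus.ofTorusSite (x + Torus.proj L e)) 1)) •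
            (creation (orb (FermionTorus.ofTorusSite (x + Torus.proj L e)) 1) *
              annihilation (orb (FermionTorus.ofTorusSite x) 0)) -
          (g (orb (FermionTorus.ofTorusSite x) 1)) •
            (creation (orb (FermionTorus.ofTorusSite x) 1) *
              annihilation (orb (FermionTorus.ofTorusSite (x + Torus.proj L e)) 0))) := by
  unfold localPair
  rw [Finset.mul_sum, Finset.sum_mul]
  refine Finset.sum_congr rfl fun e _ => ?_
  rw [Matrix.mul_smul, Matrix.smul_mul, Matrix.mul_sub, Matrix.sub_mul, shiba_conj_upDownPair hg hg0,
    shiba_conj_downUpPair hg hg0]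

/-- **The pair field under `S`**: `S Δ_{g'} Sᴴ = Σ_x S P_x Sᴴ`, the staggered transverse bond-spin
operator with form factor `g'` (explicit, `shiba_conj_localPair`).
[cite: MicnasRanningerRobaszkiewicz1990, §II.B] -/
theorem shiba_conj_pairField {g : Orb (FermionTorus 2 L) → ℂ} (hg : ∀ i, ‖g i‖ = 1)
    (hg0 : ∀ x, g (orb x 0) = 1) :
    orbitalPhase g * partialParticleHole (spinDownOrbitals : Finset (Orb (FermionTorus 2 L))) *
        pairField g' L *
        (orbitalPhase g * partialParticleHole (spinDownOrbitals : Finset (Orb (FermionTorus 2 L))))ᴴ =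
      ∑ x : TorusSite 2 L, ∑ e ∈ insert 0 unitSteps, ((g' e / Real.sqrt 2 : ℝ) : ℂ) •
        (-(g (orb (FermionTorus.ofTorusSite (x + Torus.proj L e)) 1)) •
            (creation (orb (FermionTorus.ofTorusSite (x + Torus.proj L e)) 1) *
              annihilation (orb (FermionTorus.ofTorusSite x) 0)) -
          (g (orb (FermionTorus.ofTorusSite x) 1)) •
            (creation (orb (FermionTorus.ofTorusSite x) 1) *
              annihilation (orb (FermionTorus.ofTorusSite (x + Torus.proj L e)) 0))) := by
  unfold pairField
  rw [Finset.mul_sum, Finset.sum_mul]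
  exact Finset.sum_congr rfl fun x _ => shiba_conj_localPair g' L hg hg0 x

end PairField

/-- `Sᴴ (S w) = w` (generic orbital set; used at the torus type, where writing `Sᴴ S = 1` directly
would synthesise a second `DecidableEq` instance path). [folklore] -/
theorem shiba_conjTranspose_mulVec_shiba_mulVec {Λ : Type*} [LinearOrder Λ] [Fintype Λ]
    {g : Orb Λ → ℂ} (hg : ∀ i, ‖g i‖ = 1) (w : Fock (Orb Λ)) :
    (orbitalPhase g * partialParticleHole (spinDownOrbitals : Finset (Orb Λ)))ᴴ *ᵥ
        ((orbitalPhase g * partialParticleHole (spinDownOrbitals : Finset (Orb Λ))) *ᵥ w) = w := by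
  rw [mulVec_mulVec, shiba_conjTranspose_mul_self hg, one_mulVec]

/-- `S (Sᴴ w) = w`. [folklore] -/
theorem shiba_mulVec_conjTranspose_mulVec {Λ : Type*} [LinearOrder Λ] [Fintype Λ]
    {g : Orb Λ → ℂ} (hg : ∀ i, ‖g i‖ = 1) (w : Fock (Orb Λ)) :
    (orbitalPhase g * partialParticleHole (spinDownOrbitals : Finset (Orb Λ))) *ᵥ
        ((orbitalPhase g * partialParticleHole (spinDownOrbitals : Finset (Orb Λ)))ᴴ *ᵥ w) = w := by
  rw [mulVec_mulVec, shiba_mul_conjTranspose_self hg, one_mulVec]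

/-- `‖(S A Sᴴ)(S v)‖² = ‖A v‖²` for the Shiba unitary `S` and any operator `A`. [folklore] -/
theorem star_conj_mulVec_shiba_mulVec {Λ : Type*} [LinearOrder Λ] [Fintype Λ] {g : Orb Λ → ℂ}
    (hg : ∀ i, ‖g i‖ = 1) (A : Matrix (Finset (Orb Λ)) (Finset (Orb Λ)) ℂ) (v : Fock (Orb Λ)) :
    star ((orbitalPhase g * partialParticleHole (spinDownOrbitals : Finset (Orb Λ)) * A *
          (orbitalPhase g * partialParticleHole (spinDownOrbitals : Finset (Orb Λ)))ᴴ) *ᵥ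
        ((orbitalPhase g * partialParticleHole (spinDownOrbitals : Finset (Orb Λ))) *ᵥ v)) ⬝ᵥ
      ((orbitalPhase g * partialParticleHole (spinDownOrbitals : Finset (Orb Λ)) * A *
          (orbitalPhase g * partialParticleHole (spinDownOrbitals : Finset (Orb Λ)))ᴴ) *ᵥ
        ((orbitalPhase g * partialParticleHole (spinDownOrbitals : Finset (Orb Λ))) *ᵥ v)) =
      star (A *ᵥ v) ⬝ᵥ (A *ᵥ v) := by
  set S : Matrix (Finset (Orb Λ)) (Finset (Orb Λ)) ℂ :=
    orbitalPhase g * partialParticleHole (spinDownOrbitals : Finset (Orb Λ)) with hS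
  have hSS : Sᴴ * S = 1 := shiba_conjTranspose_mul_self hg
  have h1 : (S * A * Sᴴ) *ᵥ (S *ᵥ v) = S *ᵥ (A *ᵥ v) := by
    rw [mulVec_mulVec, Matrix.mul_assoc (S * A), hSS, Matrix.mul_one, ← mulVec_mulVec]
  rw [h1]
  exact Matrix.star_mulVec_dotProduct_self_of_unitary (fun w => by rw [mulVec_mulVec, hSS, one_mulVec]) _

/-- `‖(S A Sᴴ) w‖² = ‖A (Sᴴ w)‖²`. [folklore] -/
theorem star_conj_mulVec_self {Λ : Type*} [LinearOrder Λ] [Fintype Λ] {g : Orb Λ → ℂ}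
    (hg : ∀ i, ‖g i‖ = 1) (A : Matrix (Finset (Orb Λ)) (Finset (Orb Λ)) ℂ) (w : Fock (Orb Λ)) :
    star ((orbitalPhase g * partialParticleHole (spinDownOrbitals : Finset (Orb Λ)) * A *
          (orbitalPhase g * partialParticleHole (spinDownOrbitals : Finset (Orb Λ)))ᴴ) *ᵥ w) ⬝ᵥ
      ((orbitalPhase g * partialParticleHole (spinDownOrbitals : Finset (Orb Λ)) * A *
          (orbitalPhase g * partialParticleHole (spinDownOrbitals : Finset (Orb Λ)))ᴴ) *ᵥ w) =
      star (A *ᵥ ((orbitalPhase g * partialParticleHole (spinDownOrbitals : Finset (Orb Λ)))ᴴ *ᵥ w)) ⬝ᵥ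
        (A *ᵥ ((orbitalPhase g * partialParticleHole (spinDownOrbitals : Finset (Orb Λ)))ᴴ *ᵥ w)) := by
  set S : Matrix (Finset (Orb Λ)) (Finset (Orb Λ)) ℂ :=
    orbitalPhase g * partialParticleHole (spinDownOrbitals : Finset (Orb Λ)) with hS
  have hSS' : S * Sᴴ = 1 := shiba_mul_conjTranspose_self hg
  have hw : S *ᵥ (Sᴴ *ᵥ w) = w := by rw [mulVec_mulVec, hSS', one_mulVec]
  conv_lhs => rw [← hw]
  exact star_conj_mulVec_shiba_mulVec hg A _

section TorusPhase

/-- The torus Shiba gauge evaluated on a down orbital is the stagger `(-1)^{z₁+z₂}`. [folklore] -/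
theorem shibaTorusPhase_down {L : ℕ} (z : FermionTorus 2 L) :
    (fun i : Orb (FermionTorus 2 L) =>
        if (ofLex i).2 = 1 then (((torusStagger (ofLex i).1 : ℤˣ) : ℤ) : ℂ) else (1 : ℂ)) (orb z 1) =
      (((torusStagger z : ℤˣ) : ℤ) : ℂ) := by
  dsimp only
  rw [if_pos (show (ofLex (orb z 1)).2 = 1 from rfl)]
  rfl

variable (L : ℕ) [NeZero L]

/-- **`S Δ_d Sᴴ` on the torus, explicitly**: with the stagger gauge on the down spins, the image of
the `d_{x²-y²}` pair field is the staggered transverse bond-spin operator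
`Σ_x Σ_e (d(e)/√2) (-(-1)^{x+e} c†_{(x+e)↓} c_{x↑} - (-1)^{x} c†_{x↓} c_{(x+e)↑})`.
[cite: MicnasRanningerRobaszkiewicz1990, §II.B] -/
theorem shiba_conj_pairField_dWave_torus :
    orbitalPhase (fun i : Orb (FermionTorus 2 L) =>
        if (ofLex i).2 = 1 then (((torusStagger (ofLex i).1 : ℤˣ) : ℤ) : ℂ) else (1 : ℂ)) *
        partialParticleHole (spinDownOrbitals : Finset (Orb (FermionTorus 2 L))) *
        pairField dWaveFormFactor L *
        (orbitalPhase (fun i : Orb (FermionTorus 2 L) =>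
          if (ofLex i).2 = 1 then (((torusStagger (ofLex i).1 : ℤˣ) : ℤ) : ℂ) else (1 : ℂ)) *
          partialParticleHole (spinDownOrbitals : Finset (Orb (FermionTorus 2 L))))ᴴ =
      (∑ x : Literature.Probability.LatticeModels.TorusSite 2 L, ∑ e ∈ insert 0 Literature.MathematicalPhysics.QuantumLattice.unitSteps, ((Literature.MathematicalPhysics.QuantumLattice.dWaveFormFactor e / Real.sqrt 2 : ℝ) : ℂ) • (-((((Literature.MathematicalPhysics.QuantumLattice.torusStagger (Literature.MathematicalPhysics.QuantumLattice.FermionTorus.ofTorusSite (x + Literature.Probability.LatticeModels.Torus.proj L e)) : ℤˣ) : ℤ) : ℂ)) • (Literature.MathematicalPhysics.QuantumLattice.creation (Literature.MathematicalPhysics.QuantumLattice.orb (Literature.MathematicalPhysics.QuantumLattice.FermionTorus.ofTorusSite (x + Literature.Probability.LatticeModels.Torus.proj L e)) 1) * Literature.MathematicalPhysics.QuantumLattice.annihilation (Literature.MathematicalPhysics.QuantumLattice.orb (Literature.MathematicalPhysics.QuantumLattice.FermionTorus.ofTorusSite x) 0)) - (((Literature.MathematicalPhysics.QuantumLattice.torusStagger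 (Literature.MathematicalPhysics.QuantumLattice.FermionTorus.ofTorusSite x) : ℤˣ) : ℤ) : ℂ) • (Literature.MathematicalPhysics.QuantumLattice.creation (Literature.MathematicalPhysics.QuantumLattice.orb (Literature.MathematicalPhysics.QuantumLattice.FermionTorus.ofTorusSite x) 1) * Literature.MathematicalPhysics.QuantumLattice.annihilation (Literature.MathematicalPhysics.QuantumLattice.orb (Literature.MathematicalPhysics.QuantumLattice.FermionTorus.ofTorusSite (x + Literature.Probability.LatticeModels.Torus.proj L e)) 0)))) := by
  rw [shiba_conj_pairField dWaveFormFactor L norm_shibaTorusPhase shibaTorusPhase_up]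
  simp only [shibaTorusPhase_down]

/-- **Registered sub-goal form** of `shiba_conj_pairField_dWave_torus` (binder-explicit, fully
qualified; the signature registered on stmt-HubbardSuperconductivity-2228): the Shiba image of the
`d`-wave pair field of the torus is the explicit staggered transverse bond-spin operator.
[cite: MicnasRanningerRobaszkiewicz1990, §II.B] -/
theorem jmCusp_shiba_pairField_dWave : ∀ (L : ℕ) [NeZero L], (Literature.MathematicalPhysics.QuantumLattice.orbitalPhase (fun i : Literature.MathematicalPhysics.QuantumLattice.Orb (Literature.MathematicalPhysics.QuantumLattice.FermionTorus 2 L) => if (ofLex i).2 = 1 then (((Literature.MathematicalPhysics.QuantumLattice.torusStagger (ofLex i).1 : ℤˣ) : ℤ) : ℂ) else (1 : ℂ)) * Literature.MathematicalPhysics.QuantumLattice.partialParticleHole (Literature.MathematicalPhysics.QuantumLattice.spinDownOrbitals : Finset (Literature.MathematicalPhysics.QuantumLattice.Orb (Literature.MathematicalPhysics.QuantumLattice.FermionTorus 2 L)))) * Literature.MathematicalPhysics.QuantumLattice.pairField Literature.MathematicalPhysics.QuantumLattice.dWaveFormFactor L * (Literature.MathematicalPhysics.QuantumLattice.orbitalPhase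 (fun i : Literature.MathematicalPhysics.QuantumLattice.Orb (Literature.MathematicalPhysics.QuantumLattice.FermionTorus 2 L) => if (ofLex i).2 = 1 then (((Literature.MathematicalPhysics.QuantumLattice.torusStagger (ofLex i).1 : ℤˣ) : ℤ) : ℂ) else (1 : ℂ)) * Literature.MathematicalPhysics.QuantumLattice.partialParticleHole (Literature.MathematicalPhysics.QuantumLattice.spinDownOrbitals : Finset (Literature.MathematicalPhysics.QuantumLattice.Orb (Literature.MathematicalPhysics.QuantumLattice.FermionTorus 2 L))))ᴴ = (∑ x : Literature.Probability.LatticeModels.TorusSite 2 L, ∑ e ∈ insert 0 Literature.MathematicalPhysics.QuantumLattice.unitSteps, ((Literature.MathematicalPhysics.QuantumLattice.dWaveFormFactor e / Real.sqrt 2 : ℝ) : ℂ) • (-((((Literature.MathematicalPhysics.QuantumLattice.torusStagger (Literature.MathematicalPhysics.QuantumLattice.FermionTorus.ofTorusSite (x + Literature.Probability.LatticeModels.Torus.proj L e)) : ℤˣ) : ℤ) : ℂ)) • (Literature.MathematicalPhysics.QuantumLattice.creation (Literature.MathematicalPhysics.QuantumLattice.orb (Literature.MathematicalPhysics.QuantumLattice.FermionTorus.ofTorusSite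 (x + Literature.Probability.LatticeModels.Torus.proj L e)) 1) * Literature.MathematicalPhysics.QuantumLattice.annihilation (Literature.MathematicalPhysics.QuantumLattice.orb (Literature.MathematicalPhysics.QuantumLattice.FermionTorus.ofTorusSite x) 0)) - (((Literature.MathematicalPhysics.QuantumLattice.torusStagger (Literature.MathematicalPhysics.QuantumLattice.FermionTorus.ofTorusSite x) : ℤˣ) : ℤ) : ℂ) • (Literature.MathematicalPhysics.QuantumLattice.creation (Literature.MathematicalPhysics.QuantumLattice.orb (Literature.MathematicalPhysics.QuantumLattice.FermionTorus.ofTorusSite x) 1) * Literature.MathematicalPhysics.QuantumLattice.annihilation (Literature.MathematicalPhysics.QuantumLattice.orb (Literature.MathematicalPhysics.QuantumLattice.FermionTorus.ofTorusSite (x + Literature.Probability.LatticeModels.Torus.proj L e)) 0)))) :=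
  fun L _ => shiba_conj_pairField_dWave_torus L

end TorusPhase

section Transfer

variable {L : ℕ} [NeZero L] {g : Orb (FermionTorus 2 L) → ℂ}

omit [NeZero L] in
/-- Sector bookkeeping: `(2k, S^z = 0)` is the coordinate sector `(k, k)`. [folklore] -/
theorem szSector_double_zero (k : ℕ) :
    (szSector (k + k) 0 : Submodule ℂ (Fock (Orb (FermionTorus 2 L)))) = szSector (k + k) (((k : ℝ) - k) / 2) :=
  szSector_congr rfl (by simp)

omit [NeZero L] in
/-- Sector bookkeeping: `(L², (2k - L²)/2)` is the coordinate sector `(k, L² - k)` (`k ≤ L²`). [folklore] -/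
theorem szSector_halfFilled_eq {k : ℕ} (hk : k ≤ L ^ 2) :
    (szSector (L ^ 2) ((((k + k : ℕ) : ℝ) - (L : ℝ) ^ 2) / 2) : Submodule ℂ (Fock (Orb (FermionTorus 2 L)))) =
      szSector (k + (Fintype.card (FermionTorus 2 L) - k))
        (((k : ℝ) - (Fintype.card (FermionTorus 2 L) - k : ℕ)) / 2) := by
  have hcard : Fintype.card (FermionTorus 2 L) = L ^ 2 := by simp [FermionTorus, Fintype.card_lex]
  refine szSector_congr ?_ ?_
  · rw [hcard]; omega
  · rw [hcard, Nat.cast_sub hk]; push_cast; ring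

/-- **A ZEPO witness of the repulsive torus goes to a witness of the attractive torus.**  If `v`
is a unit vector of the sector `(2k, S^z = 0)` (`k ≤ L²`) of excess energy `≤ εL²` for `H(1,U)`
with `‖Δ_d v‖² ≥ cL⁴`, then `S v` is a unit vector of the half-filled magnetised sector
`(L², k - L²/2)` with excess energy `≤ εL²` for `H(1,-U)` and `‖(S Δ_d Sᴴ)(S v)‖² ≥ cL⁴`.
[cite: Lieb1989, proof of Theorem 2] -/
theorem zepoWitness_shiba (hg : ∀ i, ‖g i‖ = 1) (hg0 : ∀ x, g (orb x 0) = 1)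
    (hg1 : ∀ x y, (fermionTorusGraph 2 L).Adj x y → g (orb x 1) * star (g (orb y 1)) = -1)
    (U ε c : ℝ) {k : ℕ} (hk : k ≤ L ^ 2) {v : Fock (Orb (FermionTorus 2 L))}
    (hv : v ∈ szSector (k + k) 0) (hv1 : star v ⬝ᵥ v = 1)
    (hE : (star v ⬝ᵥ (hubbardTorus 2 L 1 U *ᵥ v)).re ≤
      (hubbardTorus 2 L 1 U).minEnergyOn (szSector (k + k) 0) + ε * (L : ℝ) ^ 2)
    (hP : c * (L : ℝ) ^ 4 ≤ (star (pairField dWaveFormFactor L *ᵥ v) ⬝ᵥ (pairField dWaveFormFactor L *ᵥ v)).re) :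
    (orbitalPhase g * partialParticleHole spinDownOrbitals) *ᵥ v ∈
        szSector (L ^ 2) ((((k + k : ℕ) : ℝ) - (L : ℝ) ^ 2) / 2) ∧
      star ((orbitalPhase g * partialParticleHole spinDownOrbitals) *ᵥ v) ⬝ᵥ
        ((orbitalPhase g * partialParticleHole spinDownOrbitals) *ᵥ v) = 1 ∧
      (star ((orbitalPhase g * partialParticleHole spinDownOrbitals) *ᵥ v) ⬝ᵥ
          (hubbardTorus 2 L 1 (-U) *ᵥ ((orbitalPhase g * partialParticleHole spinDownOrbitals) *ᵥ v))).re ≤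
        (hubbardTorus 2 L 1 (-U)).minEnergyOn (szSector (L ^ 2) ((((k + k : ℕ) : ℝ) - (L : ℝ) ^ 2) / 2)) +
          ε * (L : ℝ) ^ 2 ∧
      c * (L : ℝ) ^ 4 ≤
        (star ((orbitalPhase g * partialParticleHole spinDownOrbitals * pairField dWaveFormFactor L *
              (orbitalPhase g * partialParticleHole spinDownOrbitals)ᴴ) *ᵥ
            ((orbitalPhase g * partialParticleHole spinDownOrbitals) *ᵥ v)) ⬝ᵥ
          ((orbitalPhase g * partialParticleHole spinDownOrbitals * pairField dWaveFormFactor L *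
              (orbitalPhase g * partialParticleHole spinDownOrbitals)ᴴ) *ᵥ
            ((orbitalPhase g * partialParticleHole spinDownOrbitals) *ᵥ v))).re := by
  have hcard : Fintype.card (FermionTorus 2 L) = L ^ 2 := by simp [FermionTorus, Fintype.card_lex]
  have hk' : k ≤ Fintype.card (FermionTorus 2 L) := by rw [hcard]; exact hk
  have hsec : IsInSector k k v := (mem_szSector_iff_isInSector k k v).1 ((szSector_double_zero k).le hv)
  have hnorm := Matrix.star_mulVec_dotProduct_self_of_unitary (shiba_conjTranspose_mulVec_shiba_mulVec hg) v
  refine ⟨?_, ?_, ?_, ?_⟩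
  · rw [szSector_halfFilled_eq hk]
    exact (mem_szSector_iff_isInSector _ _ _).2 (isInSector_shiba_mulVec g hsec)
  · rw [hnorm, hv1]
  · have hen := re_expect_shiba_mulVec (fermionTorusGraph 2 L) hg hg0 hg1 1 U hsec
    have hdict := minEnergyOn_szSector_shiba (fermionTorusGraph 2 L) hg hg0 hg1 1 U hk' hk'
    rw [szSector_halfFilled_eq hk, hubbardTorus, hen, hv1, Complex.one_re, mul_one]
    rw [hubbardTorus, szSector_double_zero k, hdict] at hE
    linarith only [hE]
  · rw [star_conj_mulVec_shiba_mulVec hg]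
    exact hP

/-- **And back under `Sᴴ`.**  If `w` is a unit vector of the half-filled sector `(L², k - L²/2)`
(`k ≤ L²`) of excess energy `≤ εL²` for `H(1,-U)` with `‖(S Δ_d Sᴴ) w‖² ≥ cL⁴`, then `Sᴴ w` is a
ZEPO witness of `H(1,U)` in `(2k, 0)`. [cite: Lieb1989, proof of Theorem 2] -/
theorem zepoWitness_shiba_conjTranspose (hg : ∀ i, ‖g i‖ = 1) (hg0 : ∀ x, g (orb x 0) = 1)
    (hg1 : ∀ x y, (fermionTorusGraph 2 L).Adj x y → g (orb x 1) * star (g (orb y 1)) = -1)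
    (U ε c : ℝ) {k : ℕ} (hk : k ≤ L ^ 2) {w : Fock (Orb (FermionTorus 2 L))}
    (hw : w ∈ szSector (L ^ 2) ((((k + k : ℕ) : ℝ) - (L : ℝ) ^ 2) / 2)) (hw1 : star w ⬝ᵥ w = 1)
    (hE : (star w ⬝ᵥ (hubbardTorus 2 L 1 (-U) *ᵥ w)).re ≤
      (hubbardTorus 2 L 1 (-U)).minEnergyOn (szSector (L ^ 2) ((((k + k : ℕ) : ℝ) - (L : ℝ) ^ 2) / 2)) +
        ε * (L : ℝ) ^ 2)
    (hP : c * (L : ℝ) ^ 4 ≤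
      (star ((orbitalPhase g * partialParticleHole spinDownOrbitals * pairField dWaveFormFactor L *
            (orbitalPhase g * partialParticleHole spinDownOrbitals)ᴴ) *ᵥ w) ⬝ᵥ
        ((orbitalPhase g * partialParticleHole spinDownOrbitals * pairField dWaveFormFactor L *
            (orbitalPhase g * partialParticleHole spinDownOrbitals)ᴴ) *ᵥ w)).re) :
    (orbitalPhase g * partialParticleHole spinDownOrbitals)ᴴ *ᵥ w ∈ szSector (k + k) 0 ∧
      star ((orbitalPhase g * partialParticleHole spinDownOrbitals)ᴴ *ᵥ w) ⬝ᵥ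
        ((orbitalPhase g * partialParticleHole spinDownOrbitals)ᴴ *ᵥ w) = 1 ∧
      (star ((orbitalPhase g * partialParticleHole spinDownOrbitals)ᴴ *ᵥ w) ⬝ᵥ
          (hubbardTorus 2 L 1 U *ᵥ ((orbitalPhase g * partialParticleHole spinDownOrbitals)ᴴ *ᵥ w))).re ≤
        (hubbardTorus 2 L 1 U).minEnergyOn (szSector (k + k) 0) + ε * (L : ℝ) ^ 2 ∧
      c * (L : ℝ) ^ 4 ≤
        (star (pairField dWaveFormFactor L *ᵥ ((orbitalPhase g * partialParticleHole spinDownOrbitals)ᴴ *ᵥ w)) ⬝ᵥ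
          (pairField dWaveFormFactor L *ᵥ ((orbitalPhase g * partialParticleHole spinDownOrbitals)ᴴ *ᵥ w))).re := by
  have hcard : Fintype.card (FermionTorus 2 L) = L ^ 2 := by simp [FermionTorus, Fintype.card_lex]
  have hk' : k ≤ Fintype.card (FermionTorus 2 L) := by rw [hcard]; exact hk
  have hsec : IsInSector k (Fintype.card (FermionTorus 2 L) - k) w :=
    (mem_szSector_iff_isInSector k _ w).1 ((szSector_halfFilled_eq hk).le hw)
  have hnorm := Matrix.star_mulVec_dotProduct_self_of_unitary
    (fun x => by rw [conjTranspose_conjTranspose]; exact shiba_mulVec_conjTranspose_mulVec hg x) w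
  refine ⟨?_, ?_, ?_, ?_⟩
  · rw [szSector_double_zero k]
    exact (mem_szSector_iff_isInSector _ _ _).2 (isInSector_shiba_conjTranspose_mulVec g hk' hsec)
  · rw [hnorm, hw1]
  · have hen := re_expect_shiba_conjTranspose_mulVec (fermionTorusGraph 2 L) hg hg0 hg1 1 U hsec
    have hdict := minEnergyOn_szSector_shiba (fermionTorusGraph 2 L) hg hg0 hg1 1 U hk' hk'
    rw [szSector_double_zero k, hubbardTorus, hen, hw1, Complex.one_re, mul_one, hdict]
    rw [hubbardTorus, szSector_halfFilled_eq hk] at hE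
    linarith only [hE]
  · rw [star_conj_mulVec_self hg] at hP
    exact hP

end Transfer

/-- The two admissible particle numbers `N_L` and `N_L - 2` are even and at most `2L²` (`δ ≥ 0`).
[folklore] -/
theorem exists_half_of_admissible {δ : ℝ} (hδ : 0 ≤ δ) (L : ℕ) {n : ℕ}
    (hn : n = 2 * ⌊(1 - δ) * (L : ℝ) ^ 2 / 2⌋₊ ∨ n = 2 * ⌊(1 - δ) * (L : ℝ) ^ 2 / 2⌋₊ - 2) :
    ∃ k : ℕ, n = k + k ∧ k ≤ L ^ 2 := by
  have hfl : ⌊(1 - δ) * (L : ℝ) ^ 2 / 2⌋₊ ≤ L ^ 2 :=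
    Nat.floor_le_of_le (by push_cast; nlinarith [sq_nonneg (L : ℝ)])
  rcases hn with rfl | rfl
  · exact ⟨⌊(1 - δ) * (L : ℝ) ^ 2 / 2⌋₊, two_mul _, hfl⟩
  · exact ⟨⌊(1 - δ) * (L : ℝ) ^ 2 / 2⌋₊ - 1, by omega, by omega⟩

/-- **ZEPO at `(U, δ)` in attractive language.**  For every `U` and every `δ ≥ 0`: zero-excess
`d`-wave pair order of the repulsive torus `hubbardTorus 2 L 1 U` at doping `δ` (verbatim the
window predicate of `stub_orderedWindow` at one coupling; equivalently clause (i) of `JmCusp` at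
`(U, δ)`, p134917) holds iff the ATTRACTIVE torus `hubbardTorus 2 L 1 (-U)` at HALF FILLING carries
zero-excess STAGGERED TRANSVERSE `d`-WAVE BOND-SPIN order in the magnetised sectors
`S^z = (n - L²)/2`, `n ∈ {N_L, N_L - 2}`: low-energy unit vectors `w` of those sectors with
`‖𝒯_L w‖² ≥ cL⁴`, `𝒯_L = S Δ_d Sᴴ` the explicit operator of `shiba_conj_pairField_dWave_torus`.
[cite: Lieb1989, proof of Theorem 2; MicnasRanningerRobaszkiewicz1990, §II.B] -/
theorem zeroExcessPairOrder_iff_attractive (U δ : ℝ) (hδ : 0 ≤ δ) :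
    (∃ c : ℝ, 0 < c ∧ ∀ ε : ℝ, 0 < ε → ∃ L₀ : ℕ, ∀ (L : ℕ) [NeZero L], Even L → L₀ ≤ L → ∃ n : ℕ, (n = 2 * ⌊(1 - δ) * (L : ℝ) ^ 2 / 2⌋₊ ∨ n = 2 * ⌊(1 - δ) * (L : ℝ) ^ 2 / 2⌋₊ - 2) ∧ ∃ v : Literature.MathematicalPhysics.QuantumLattice.Fock (Literature.MathematicalPhysics.QuantumLattice.Orb (Literature.MathematicalPhysics.QuantumLattice.FermionTorus 2 L)), v ∈ Literature.MathematicalPhysics.QuantumLattice.szSector n 0 ∧ star v ⬝ᵥ v = 1 ∧ (star v ⬝ᵥ (Literature.MathematicalPhysics.QuantumLattice.hubbardTorus 2 L 1 U *ᵥ v)).re ≤ (Literature.MathematicalPhysics.QuantumLattice.hubbardTorus 2 L 1 U).minEnergyOn (Literature.MathematicalPhysics.QuantumLattice.szSector n 0) + ε * (L : ℝ) ^ 2 ∧ c * (L : ℝ) ^ 4 ≤ (star (Literature.MathematicalPhysics.QuantumLattice.pairField Literature.MathematicalPhysics.QuantumLattice.dWaveFormFactor L *ᵥ v) ⬝ᵥ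 (Literature.MathematicalPhysics.QuantumLattice.pairField Literature.MathematicalPhysics.QuantumLattice.dWaveFormFactor L *ᵥ v)).re) ↔
      (∃ c : ℝ, 0 < c ∧ ∀ ε : ℝ, 0 < ε → ∃ L₀ : ℕ, ∀ (L : ℕ) [NeZero L], Even L → L₀ ≤ L → ∃ n : ℕ, (n = 2 * ⌊(1 - δ) * (L : ℝ) ^ 2 / 2⌋₊ ∨ n = 2 * ⌊(1 - δ) * (L : ℝ) ^ 2 / 2⌋₊ - 2) ∧ ∃ w : Literature.MathematicalPhysics.QuantumLattice.Fock (Literature.MathematicalPhysics.QuantumLattice.Orb (Literature.MathematicalPhysics.QuantumLattice.FermionTorus 2 L)), w ∈ Literature.MathematicalPhysics.QuantumLattice.szSector (L ^ 2) (((n : ℝ) - (L : ℝ) ^ 2) / 2) ∧ star w ⬝ᵥ w = 1 ∧ (star w ⬝ᵥ (Literature.MathematicalPhysics.QuantumLattice.hubbardTorus 2 L 1 (-U) *ᵥ w)).re ≤ (Literature.MathematicalPhysics.QuantumLattice.hubbardTorus 2 L 1 (-U)).minEnergyOn (Literature.MathematicalPhysics.QuantumLattice.szSector (L ^ 2) (((n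 : ℝ) - (L : ℝ) ^ 2) / 2)) + ε * (L : ℝ) ^ 2 ∧ c * (L : ℝ) ^ 4 ≤ (star ((∑ x : Literature.Probability.LatticeModels.TorusSite 2 L, ∑ e ∈ insert 0 Literature.MathematicalPhysics.QuantumLattice.unitSteps, ((Literature.MathematicalPhysics.QuantumLattice.dWaveFormFactor e / Real.sqrt 2 : ℝ) : ℂ) • (-((((Literature.MathematicalPhysics.QuantumLattice.torusStagger (Literature.MathematicalPhysics.QuantumLattice.FermionTorus.ofTorusSite (x + Literature.Probability.LatticeModels.Torus.proj L e)) : ℤˣ) : ℤ) : ℂ)) • (Literature.MathematicalPhysics.QuantumLattice.creation (Literature.MathematicalPhysics.QuantumLattice.orb (Literature.MathematicalPhysics.QuantumLattice.FermionTorus.ofTorusSite (x + Literature.Probability.LatticeModels.Torus.proj L e)) 1) * Literature.MathematicalPhysics.QuantumLattice.annihilation (Literature.MathematicalPhysics.QuantumLattice.orb (Literature.MathematicalPhysics.QuantumLattice.FermionTorus.ofTorusSite x) 0)) - (((Literature.MathematicalPhysics.QuantumLattice.torusStagger (Literature.MathematicalPhysics.QuantumLattice.FermionTorus.ofTorusSite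 x) : ℤˣ) : ℤ) : ℂ) • (Literature.MathematicalPhysics.QuantumLattice.creation (Literature.MathematicalPhysics.QuantumLattice.orb (Literature.MathematicalPhysics.QuantumLattice.FermionTorus.ofTorusSite x) 1) * Literature.MathematicalPhysics.QuantumLattice.annihilation (Literature.MathematicalPhysics.QuantumLattice.orb (Literature.MathematicalPhysics.QuantumLattice.FermionTorus.ofTorusSite (x + Literature.Probability.LatticeModels.Torus.proj L e)) 0)))) *ᵥ w) ⬝ᵥ ((∑ x : Literature.Probability.LatticeModels.TorusSite 2 L, ∑ e ∈ insert 0 Literature.MathematicalPhysics.QuantumLattice.unitSteps, ((Literature.MathematicalPhysics.QuantumLattice.dWaveFormFactor e / Real.sqrt 2 : ℝ) : ℂ) • (-((((Literature.MathematicalPhysics.QuantumLattice.torusStagger (Literature.MathematicalPhysics.QuantumLattice.FermionTorus.ofTorusSite (x + Literature.Probability.LatticeModels.Torus.proj L e)) : ℤˣ) : ℤ) : ℂ)) • (Literature.MathematicalPhysics.QuantumLattice.creation (Literature.MathematicalPhysics.QuantumLattice.orb (Literature.MathematicalPhysics.QuantumLattice.FermionTorus.ofTorusSite (x + Literature.Probability.LatticeModels.Torus.proj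 L e)) 1) * Literature.MathematicalPhysics.QuantumLattice.annihilation (Literature.MathematicalPhysics.QuantumLattice.orb (Literature.MathematicalPhysics.QuantumLattice.FermionTorus.ofTorusSite x) 0)) - (((Literature.MathematicalPhysics.QuantumLattice.torusStagger (Literature.MathematicalPhysics.QuantumLattice.FermionTorus.ofTorusSite x) : ℤˣ) : ℤ) : ℂ) • (Literature.MathematicalPhysics.QuantumLattice.creation (Literature.MathematicalPhysics.QuantumLattice.orb (Literature.MathematicalPhysics.QuantumLattice.FermionTorus.ofTorusSite x) 1) * Literature.MathematicalPhysics.QuantumLattice.annihilation (Literature.MathematicalPhysics.QuantumLattice.orb (Literature.MathematicalPhysics.QuantumLattice.FermionTorus.ofTorusSite (x + Literature.Probability.LatticeModels.Torus.proj L e)) 0)))) *ᵥ w)).re) := by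
  constructor
  · rintro ⟨c, hc, h⟩
    refine ⟨c, hc, fun ε hε => ?_⟩
    obtain ⟨L₀, hL₀⟩ := h ε hε
    refine ⟨L₀, fun L _ hE hL => ?_⟩
    obtain ⟨n, hn, v, hv, hv1, hEv, hPv⟩ := hL₀ L hE hL
    obtain ⟨k, rfl, hk⟩ := exists_half_of_admissible hδ L hn
    obtain ⟨h1, h2, h3, h4⟩ := zepoWitness_shiba norm_shibaTorusPhase shibaTorusPhase_up
      (fun x y hxy => shibaTorusPhase_down_bond hE hxy) U ε c hk hv hv1 hEv hPv
    refine ⟨k + k, hn, _, h1, h2, h3, ?_⟩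
    rw [← shiba_conj_pairField_dWave_torus L]
    exact h4
  · rintro ⟨c, hc, h⟩
    refine ⟨c, hc, fun ε hε => ?_⟩
    obtain ⟨L₀, hL₀⟩ := h ε hε
    refine ⟨L₀, fun L _ hE hL => ?_⟩
    obtain ⟨n, hn, w, hw, hw1, hEw, hPw⟩ := hL₀ L hE hL
    obtain ⟨k, rfl, hk⟩ := exists_half_of_admissible hδ L hn
    rw [← shiba_conj_pairField_dWave_torus L] at hPw
    obtain ⟨h1, h2, h3, h4⟩ := zepoWitness_shiba_conjTranspose norm_shibaTorusPhase shibaTorusPhase_up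
      (fun x y hxy => shibaTorusPhase_down_bond hE hxy) U ε c hk hw hw1 hEw hPw
    exact ⟨k + k, hn, _, h1, h2, h3, h4⟩

/-- **The registered stub `stub_orderedWindow` in attractive language**: a coupling window of
zero-excess `d`-wave pair order of the repulsive torus at some doping `δ ∈ (0, 1/2)` exists iff a
coupling window exists on which the attractive half-filled torus `hubbardTorus 2 L 1 (-U)` carries
zero-excess staggered transverse `d`-wave bond-spin order in the magnetised sectors
`S^z = (n - L²)/2`, `n ∈ {N_L, N_L - 2}`. [cite: Lieb1989, proof of Theorem 2] -/
theorem orderedWindow_iff_attractive : (∃ δ ∈ Set.Ioo (0:ℝ) (1 / 2), ∃ a b : ℝ, 0 < a ∧ a < b ∧ ∀ U ∈ Set.Ioo a b, ∃ c : ℝ, 0 < c ∧ ∀ ε : ℝ, 0 < ε → ∃ L₀ : ℕ, ∀ (L : ℕ) [NeZero L], Even L → L₀ ≤ L → ∃ n : ℕ, (n = 2 * ⌊(1 - δ) * (L : ℝ) ^ 2 / 2⌋₊ ∨ n = 2 * ⌊(1 - δ) * (L : ℝ) ^ 2 / 2⌋₊ - 2) ∧ ∃ v : Literature.MathematicalPhysics.QuantumLattice.Fock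 (Literature.MathematicalPhysics.QuantumLattice.Orb (Literature.MathematicalPhysics.QuantumLattice.FermionTorus 2 L)), v ∈ Literature.MathematicalPhysics.QuantumLattice.szSector n 0 ∧ star v ⬝ᵥ v = 1 ∧ (star v ⬝ᵥ (Literature.MathematicalPhysics.QuantumLattice.hubbardTorus 2 L 1 U *ᵥ v)).re ≤ (Literature.MathematicalPhysics.QuantumLattice.hubbardTorus 2 L 1 U).minEnergyOn (Literature.MathematicalPhysics.QuantumLattice.szSector n 0) + ε * (L : ℝ) ^ 2 ∧ c * (L : ℝ) ^ 4 ≤ (star (Literature.MathematicalPhysics.QuantumLattice.pairField Literature.MathematicalPhysics.QuantumLattice.dWaveFormFactor L *ᵥ v) ⬝ᵥ (Literature.MathematicalPhysics.QuantumLattice.pairField Literature.MathematicalPhysics.QuantumLattice.dWaveFormFactor L *ᵥ v)).re) ↔ (∃ δ ∈ Set.Ioo (0:ℝ) (1 / 2), ∃ a b : ℝ, 0 < a ∧ a < b ∧ ∀ U ∈ Set.Ioo a b, ∃ c : ℝ, 0 < c ∧ ∀ ε : ℝ, 0 < ε → ∃ L₀ : ℕ, ∀ (L : ℕ) [NeZero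 L], Even L → L₀ ≤ L → ∃ n : ℕ, (n = 2 * ⌊(1 - δ) * (L : ℝ) ^ 2 / 2⌋₊ ∨ n = 2 * ⌊(1 - δ) * (L : ℝ) ^ 2 / 2⌋₊ - 2) ∧ ∃ w : Literature.MathematicalPhysics.QuantumLattice.Fock (Literature.MathematicalPhysics.QuantumLattice.Orb (Literature.MathematicalPhysics.QuantumLattice.FermionTorus 2 L)), w ∈ Literature.MathematicalPhysics.QuantumLattice.szSector (L ^ 2) (((n : ℝ) - (L : ℝ) ^ 2) / 2) ∧ star w ⬝ᵥ w = 1 ∧ (star w ⬝ᵥ (Literature.MathematicalPhysics.QuantumLattice.hubbardTorus 2 L 1 (-U) *ᵥ w)).re ≤ (Literature.MathematicalPhysics.QuantumLattice.hubbardTorus 2 L 1 (-U)).minEnergyOn (Literature.MathematicalPhysics.QuantumLattice.szSector (L ^ 2) (((n : ℝ) - (L : ℝ) ^ 2) / 2)) + ε * (L : ℝ) ^ 2 ∧ c * (L : ℝ) ^ 4 ≤ (star ((∑ x : Literature.Probability.LatticeModels.TorusSite 2 L, ∑ e ∈ insert 0 Literature.MathematicalPhysics.QuantumLattice.unitSteps,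 ((Literature.MathematicalPhysics.QuantumLattice.dWaveFormFactor e / Real.sqrt 2 : ℝ) : ℂ) • (-((((Literature.MathematicalPhysics.QuantumLattice.torusStagger (Literature.MathematicalPhysics.QuantumLattice.FermionTorus.ofTorusSite (x + Literature.Probability.LatticeModels.Torus.proj L e)) : ℤˣ) : ℤ) : ℂ)) • (Literature.MathematicalPhysics.QuantumLattice.creation (Literature.MathematicalPhysics.QuantumLattice.orb (Literature.MathematicalPhysics.QuantumLattice.FermionTorus.ofTorusSite (x + Literature.Probability.LatticeModels.Torus.proj L e)) 1) * Literature.MathematicalPhysics.QuantumLattice.annihilation (Literature.MathematicalPhysics.QuantumLattice.orb (Literature.MathematicalPhysics.QuantumLattice.FermionTorus.ofTorusSite x) 0)) - (((Literature.MathematicalPhysics.QuantumLattice.torusStagger (Literature.MathematicalPhysics.QuantumLattice.FermionTorus.ofTorusSite x) : ℤˣ) : ℤ) : ℂ) • (Literature.MathematicalPhysics.QuantumLattice.creation (Literature.MathematicalPhysics.QuantumLattice.orb (Literature.MathematicalPhysics.QuantumLattice.FermionTorus.ofTorusSite x) 1) * Literature.MathematicalPhysics.QuantumLattice.annihilation (Literature.MathematicalPhysics.QuantumLattice.orb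 (Literature.MathematicalPhysics.QuantumLattice.FermionTorus.ofTorusSite (x + Literature.Probability.LatticeModels.Torus.proj L e)) 0)))) *ᵥ w) ⬝ᵥ ((∑ x : Literature.Probability.LatticeModels.TorusSite 2 L, ∑ e ∈ insert 0 Literature.MathematicalPhysics.QuantumLattice.unitSteps, ((Literature.MathematicalPhysics.QuantumLattice.dWaveFormFactor e / Real.sqrt 2 : ℝ) : ℂ) • (-((((Literature.MathematicalPhysics.QuantumLattice.torusStagger (Literature.MathematicalPhysics.QuantumLattice.FermionTorus.ofTorusSite (x + Literature.Probability.LatticeModels.Torus.proj L e)) : ℤˣ) : ℤ) : ℂ)) • (Literature.MathematicalPhysics.QuantumLattice.creation (Literature.MathematicalPhysics.QuantumLattice.orb (Literature.MathematicalPhysics.QuantumLattice.FermionTorus.ofTorusSite (x + Literature.Probability.LatticeModels.Torus.proj L e)) 1) * Literature.MathematicalPhysics.QuantumLattice.annihilation (Literature.MathematicalPhysics.QuantumLattice.orb (Literature.MathematicalPhysics.QuantumLattice.FermionTorus.ofTorusSite x) 0)) - (((Literature.MathematicalPhysics.QuantumLattice.torusStagger (Literature.MathematicalPhysics.QuantumLattice.FermionTorus.ofTorusSite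 x) : ℤˣ) : ℤ) : ℂ) • (Literature.MathematicalPhysics.QuantumLattice.creation (Literature.MathematicalPhysics.QuantumLattice.orb (Literature.MathematicalPhysics.QuantumLattice.FermionTorus.ofTorusSite x) 1) * Literature.MathematicalPhysics.QuantumLattice.annihilation (Literature.MathematicalPhysics.QuantumLattice.orb (Literature.MathematicalPhysics.QuantumLattice.FermionTorus.ofTorusSite (x + Literature.Probability.LatticeModels.Torus.proj L e)) 0)))) *ᵥ w)).re) := by
  constructor
  · rintro ⟨δ, hδ, a, b, ha, hab, h⟩
    exact ⟨δ, hδ, a, b, ha, hab, fun U hU => (zeroExcessPairOrder_iff_attractive U δ hδ.1.le).1 (h U hU)⟩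
  · rintro ⟨δ, hδ, a, b, ha, hab, h⟩
    exact ⟨δ, hδ, a, b, ha, hab, fun U hU => (zeroExcessPairOrder_iff_attractive U δ hδ.1.le).2 (h U hU)⟩

end Summit.HubbardSuperconductivity.HubbardSuperconductivity.Theorems.JosephsonMirror

end
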